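import Summits.CriticalPhenomena.Ising3D.TaylorTableEvenHeadFast
import Summits.CriticalPhenomena.Ising3D.TaylorRegionTableRows
import Summits.CriticalPhenomena.Ising3D.TaylorRegionSplitEven
import Mathlib.Tactic.Linarith
import HarnessLib

/-!
# The TABLE layer of a derivative certificate, XVI: kernel-cheap ROWS for the FAST even head (literal `(P,D)` tables + table rows) and the cell theorems on the existential row contract
(cell `pub-ising3x`, seat boot-1 gen 7; gate (g2) cost repair, part 3)

HONEST FRAMING: lottery ticket; floor = tightest certified 3D Ising CFT bounds; no exact-solution
claim without a proof. Island framing: certified exclusion region at stated derivative order and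
assumptions; not a determination of the 3D Ising critical exponents beyond that.

MEASURED (HOME/pub-ising3x-boot-1/COST-HEAD-KERNEL.md §4): the zeroth-order row check of `TaylorTableEvenHeadFast`
(`EvenRows.check`: containment of recog-1's `qRowI` rows) costs ≈ 8·(j+1)² kernel-seconds per row (j = 4: 200 s) —
unusable for `J = 24…40`. recog-1 g11 met the same wall and repaired it with rows read off the `(P, D)` table
(`TaylorRegionTableRows`: `qRowOfTableI` = `Σ_k hMoment(k,j) • Q[2k]`, `O(N·Λ)` per row, table built once). This file
brings that repair to the head layer: (1) the row contract in EXISTENTIAL form `EvenRows.ValidE` (for every `(Δσ, Δε)`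
of the box and `j < J` SOME real coefficient list in the carried row evaluates to the q-sum) — implied by `Valid`
(`validE_of_valid`); (2) literal `(P, D)` tables as certificate data (`EvenTables`), one containment declaration per
table (`tableOKX/Y/Zm/Zp`: `kernelSizeOK` + `subset2I (kernelPDLI …) T`), then ALL rows from the literal tables in one
cheap declaration (`checkRowsT`), giving `ValidE` (`validE_of_tables`); (3) the cell theorems of `…EvenHeadFast` /
restated on `ValidE`: **`evenHead_nonneg_of_tmOK_E`** (same conclusion; the parts twin `…_of_parts_E` is the successor's
one-screen copy once `TaylorTableEvenHeadParts` has an olean). Zeroth order in the box width as before (point / narrow boxes; the δ-expansion of recog-1 g12 is the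
upgrade path). No new mathematics. [folklore]
-/

namespace Summit.CriticalPhenomena.Ising3D

open Finset Set
open Literature.Analysis.ValidatedNumerics Literature.Analysis.ValidatedNumerics.PolyMP
open Literature.Analysis.ValidatedNumerics.NumericsMP (MI)
open Literature.MathematicalPhysics.QuantumFieldTheory.ConformalBootstrap3D

/-! ### Containment of tables: `subset2I` / `pmem2_of_subset2I` are recog-1's (TaylorRegionSplitEven). -/

namespace EvenRows

variable (R : EvenRows)

/-! ### The existential row contract -/

/-- **Existential row contract**: positive scale and, for every `(Δσ, Δε)` of the box and `j < J`, each carried row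
contains SOME real coefficient list evaluating to the corresponding q-sum (`X̂`, `Ŷ`, `Ẑ₋ + Ẑ₊`). [folklore] -/
def ValidE (c : Fin 5 → ℕ × ℕ → ℚ) (L : List (ℕ × ℕ)) (σlo σhi εlo εhi : ℚ) : Prop :=
  0 < R.S ∧ ∀ Δσ ∈ Icc (σlo : ℝ) σhi, ∀ Δε ∈ Icc (εlo : ℝ) εhi, ∀ j < R.J,
    (∃ as : List ℝ, PMem R.S as (R.RX.getD j []) ∧
      ∀ E : ℝ, qSum (fun ab => (c 0 ab : ℝ)) L.toFinset Δσ (-1) E j = evalR as E) ∧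
    (∃ as : List ℝ, PMem R.S as (R.RY.getD j []) ∧
      ∀ E : ℝ, qSum (fun ab => (c 1 ab : ℝ)) L.toFinset Δε (-1) E j = evalR as E) ∧
    (∃ as : List ℝ, PMem R.S as (R.RZ.getD j []) ∧
      ∀ E : ℝ, qSum (fun ab => (c 3 ab : ℝ)) L.toFinset ((Δσ + Δε) / 2) (-1) E j +
        qSum (fun ab => (c 4 ab : ℝ)) L.toFinset ((Δσ + Δε) / 2) 1 E j = evalR as E)

/-- `Valid` (the `qRow` lists) implies `ValidE`. [folklore] -/
theorem validE_of_valid {c : Fin 5 → ℕ × ℕ → ℚ} {L : List (ℕ × ℕ)} (hL : L.Nodup) {σlo σhi εlo εhi : ℚ}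
    (h : R.Valid c L σlo σhi εlo εhi) : R.ValidE c L σlo σhi εlo εhi := by
  refine ⟨h.1, fun Δσ hσ Δε hε j hj => ?_⟩
  obtain ⟨hx, hy, hz⟩ := h.2 Δσ hσ Δε hε j hj
  refine ⟨⟨_, hx, fun E => ?_⟩, ⟨_, hy, fun E => ?_⟩, ⟨_, hz, fun E => ?_⟩⟩
  · have e := qSum_eq_evalR_qRow (c 0) (-1) Δσ hL j E
    push_cast at e; exact e
  · have e := qSum_eq_evalR_qRow (c 1) (-1) Δε hL j E
    push_cast at e; exact e
  · have e3 := qSum_eq_evalR_qRow (c 3) (-1) ((Δσ + Δε) / 2) hL j E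
    have e4 := qSum_eq_evalR_qRow (c 4) 1 ((Δσ + Δε) / 2) hL j E
    push_cast at e3 e4
    rw [rowZ, evalR_addR, e3, e4]

/-! ### Literal tables and table rows -/

/-- Literal `(P, D)` tables of the four row families (`cc = 0`, so `P = E`) and the moment count `N`. [folklore] -/
structure EvenTables where
  /-- number of moments -/
  N : ℕ
  /-- table of component `0` at `s = Δσ`, `σ = -1` -/
  TX : IPoly2
  /-- table of component `1` at `s = Δε`, `σ = -1` -/
  TY : IPoly2
  /-- table of component `3` at `s = s̄`, `σ = -1` -/
  TZm : IPoly2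
  /-- table of component `4` at `s = s̄`, `σ = +1` -/
  TZp : IPoly2

/-- Table check, component `0` (one declaration). [folklore] -/
def tableOKX (c : Fin 5 → ℕ × ℕ → ℚ) (L : List (ℕ × ℕ)) (σlo σhi : ℚ) (T : EvenTables) : Bool :=
  kernelSizeOK R.S (c 0) (-1) (ratIvl R.S σlo σhi) 0 L T.N &&
    subset2I (kernelPDLI R.S (c 0) (-1) (signedChooseI R.S (ratIvl R.S σlo σhi)) 0 L) T.TX
/-- Table check, component `1`. [folklore] -/
def tableOKY (c : Fin 5 → ℕ × ℕ → ℚ) (L : List (ℕ × ℕ)) (εlo εhi : ℚ) (T : EvenTables) : Bool :=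
  kernelSizeOK R.S (c 1) (-1) (ratIvl R.S εlo εhi) 0 L T.N &&
    subset2I (kernelPDLI R.S (c 1) (-1) (signedChooseI R.S (ratIvl R.S εlo εhi)) 0 L) T.TY
/-- Table check, component `3`. [folklore] -/
def tableOKZm (c : Fin 5 → ℕ × ℕ → ℚ) (L : List (ℕ × ℕ)) (σlo σhi εlo εhi : ℚ) (T : EvenTables) : Bool :=
  kernelSizeOK R.S (c 3) (-1) (ratIvl R.S ((σlo + εlo) / 2) ((σhi + εhi) / 2)) 0 L T.N &&
    subset2I (kernelPDLI R.S (c 3) (-1) (signedChooseI R.S (ratIvl R.S ((σlo + εlo) / 2) ((σhi + εhi) / 2))) 0 L) T.TZm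
/-- Table check, component `4`. [folklore] -/
def tableOKZp (c : Fin 5 → ℕ × ℕ → ℚ) (L : List (ℕ × ℕ)) (σlo σhi εlo εhi : ℚ) (T : EvenTables) : Bool :=
  kernelSizeOK R.S (c 4) 1 (ratIvl R.S ((σlo + εlo) / 2) ((σhi + εhi) / 2)) 0 L T.N &&
    subset2I (kernelPDLI R.S (c 4) 1 (signedChooseI R.S (ratIvl R.S ((σlo + εlo) / 2) ((σhi + εhi) / 2))) 0 L) T.TZp

/-- Row `j` from the literal tables is contained in the carried rows. [folklore] -/
def rowsOKT (T : EvenTables) (j : ℕ) : Bool :=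
  subsetI (qRowOfTableI T.TX T.N j) (R.RX.getD j []) && subsetI (qRowOfTableI T.TY T.N j) (R.RY.getD j []) &&
    subsetI (addI (qRowOfTableI T.TZm T.N j) (qRowOfTableI T.TZp T.N j)) (R.RZ.getD j [])

/-- Rows `a ≤ j < b` from the literal tables (cheap: `O((b-a)·N·Λ)`). [folklore] -/
def checkRowsT (T : EvenTables) (a b : ℕ) : Bool :=
  (List.range (b - a)).all fun i => R.rowsOKT T (a + i)

/-- [folklore] -/
theorem rowsOKT_of_checkRowsT {T : EvenTables} {a b : ℕ} (h : R.checkRowsT T a b = true) {j : ℕ}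
    (haj : a ≤ j) (hjb : j < b) : R.rowsOKT T j = true := by
  simp only [checkRowsT, List.all_eq_true, List.mem_range] at h
  have := h (j - a) (by omega)
  rwa [show a + (j - a) = j by omega] at this

/-- Gluing two row ranges. [folklore] -/
theorem checkRowsT_append {T : EvenTables} {a b d : ℕ} (h1 : R.checkRowsT T a b = true)
    (h2 : R.checkRowsT T b d = true) : R.checkRowsT T a d = true := by
  simp only [checkRowsT, List.all_eq_true, List.mem_range]
  intro i hi
  by_cases hlt : a + i < b
  · exact R.rowsOKT_of_checkRowsT h1 (by omega) hlt
  · exact R.rowsOKT_of_checkRowsT h2 (by omega) (by omega)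

/-- **`ValidE` from literal tables**: the four table declarations, all rows from the tables, positive scale.
[folklore] -/
theorem validE_of_tables {c : Fin 5 → ℕ × ℕ → ℚ} {L : List (ℕ × ℕ)} (hL : L.Nodup) {σlo σhi εlo εhi : ℚ}
    {T : EvenTables} (hS : 0 < R.S) (hX : R.tableOKX c L σlo σhi T = true) (hY : R.tableOKY c L εlo εhi T = true)
    (hZm : R.tableOKZm c L σlo σhi εlo εhi T = true) (hZp : R.tableOKZp c L σlo σhi εlo εhi T = true)
    (hrows : R.checkRowsT T 0 R.J = true) : R.ValidE c L σlo σhi εlo εhi := by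
  simp only [tableOKX, tableOKY, tableOKZm, tableOKZp, Bool.and_eq_true] at hX hY hZm hZp
  refine ⟨hS, fun Δσ hσ Δε hε j hj => ?_⟩
  have hrow := R.rowsOKT_of_checkRowsT hrows (Nat.zero_le j) hj
  simp only [rowsOKT, Bool.and_eq_true] at hrow
  obtain ⟨⟨hx, hy⟩, hz⟩ := hrow
  have hsσ := mem_ratIvl R.S hσ.1 hσ.2
  have hsε := mem_ratIvl R.S hε.1 hε.2
  have hsb : MI.mem R.S ((Δσ + Δε) / 2) (ratIvl R.S ((σlo + εlo) / 2) ((σhi + εhi) / 2)) := by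
    refine mem_ratIvl R.S ?_ ?_
    · push_cast; linarith [hσ.1, hε.1]
    · push_cast; linarith [hσ.2, hε.2]
  have h0 : ((0 : ℚ) : ℝ) = 0 := by norm_num
  refine ⟨⟨_, pmem_of_subsetI (pmem_qRowOfTableI (pmem2_of_subset2I (pmem2_kernelPDLI_of_mem hS hsσ (c 0) (-1) 0 L) hX.2) T.N j) hx,
      fun E => ?_⟩,
    ⟨_, pmem_of_subsetI (pmem_qRowOfTableI (pmem2_of_subset2I (pmem2_kernelPDLI_of_mem hS hsε (c 1) (-1) 0 L) hY.2) T.N j) hy,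
      fun E => ?_⟩,
    ⟨_, pmem_of_subsetI (pmem_addI
        (pmem_qRowOfTableI (pmem2_of_subset2I (pmem2_kernelPDLI_of_mem hS hsb (c 3) (-1) 0 L) hZm.2) T.N j)
        (pmem_qRowOfTableI (pmem2_of_subset2I (pmem2_kernelPDLI_of_mem hS hsb (c 4) 1 0 L) hZp.2) T.N j)) hz,
      fun E => ?_⟩⟩
  · have e := qSum_eq_evalR_qRowOfTable hS (c 0) (-1) hsσ 0 hL hX.1 E j
    push_cast at e; simpa using e
  · have e := qSum_eq_evalR_qRowOfTable hS (c 1) (-1) hsε 0 hL hY.1 E j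
    push_cast at e; simpa using e
  · have e3 := qSum_eq_evalR_qRowOfTable hS (c 3) (-1) hsb 0 hL hZm.1 E j
    have e4 := qSum_eq_evalR_qRowOfTable hS (c 4) 1 hsb 0 hL hZp.1 E j
    rw [evalR_addR]
    push_cast at e3 e4 ⊢
    simp only [sub_zero] at e3 e4
    rw [e3, e4]

end EvenRows

/-! ### The cell theorems on `ValidE` -/

/-- Core of the cell theorems: from coefficient lists in three interval polynomials that pass the sign tests and
evaluate (at `ρ = Δ - ctr`) to `X̃`, `Ỹ`, `Z̃`, the head form is PSD at `(p, Δ)`. [cite: KosPolandSimmonsduffin2014, §3.3 eq. (3.16)] -/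
theorem evenHead_psd_of_pmem (c : Fin 5 → ℕ × ℕ → ℚ) (L : List (ℕ × ℕ)) {C : EvenCellTM} (hF : C.F.Nodup)
    (hFj : ∀ q ∈ C.F, q.2 ≤ C.ℓ + q.1) (hℓlo : (C.ℓ : ℚ) ≤ C.lo) {S : ℕ} (hS : 0 < S) {dP : ℕ} {HX HY HZ : IPoly}
    (hX : posOn S dP HX (-C.hw) C.hw = true) (hY : posOn S dP HY (-C.hw) C.hw = true)
    (hD : posOnD S HX HY HZ dP (-C.hw) C.hw = true) (p : ℝ × ℝ) {Δ : ℝ} (hlo : (C.lo : ℝ) ≤ Δ) (hhi : Δ ≤ C.hi)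
    {ax ay az : List ℝ} (hax : PMem S ax HX) (hay : PMem S ay HY) (haz : PMem S az HZ)
    (ex : evalR ax (Δ - C.ctr) = evenHeadX (fun ab => (c 0 ab : ℝ)) L.toFinset C.ℓ C.F p.1 Δ (-1))
    (ey : evalR ay (Δ - C.ctr) = evenHeadX (fun ab => (c 1 ab : ℝ)) L.toFinset C.ℓ C.F p.2 Δ (-1))
    (ez : evalR az (Δ - C.ctr) = evenHeadX (fun ab => (c 3 ab : ℝ)) L.toFinset C.ℓ C.F ((p.1 + p.2) / 2) Δ (-1) +
      evenHeadX (fun ab => (c 4 ab : ℝ)) L.toFinset C.ℓ C.F ((p.1 + p.2) / 2) Δ 1) (a b : ℝ) :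
    0 ≤ ∑ q ∈ C.F.toFinset, hrCoeff Δ C.ℓ q.1 q.2 / legendreLam C.ℓ *
      (taylorCrossing (1 / 2) (1 / 2) L.toFinset (fun i ab => (c i ab : ℝ))).evenForm p.1 p.2
        (zMono (Δ + (q.1 : ℝ)) q.2) a b := by
  have hlo' : ((C.lo : ℚ) : ℝ) = (C.ctr : ℝ) - ((C.hw : ℚ) : ℝ) := by rw [EvenCellTM.lo]; push_cast; ring
  have hhi' : ((C.hi : ℚ) : ℝ) = (C.ctr : ℝ) + ((C.hw : ℚ) : ℝ) := by rw [EvenCellTM.hi]; push_cast; ring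
  have hρ1 : ((-C.hw : ℚ) : ℝ) ≤ Δ - C.ctr := by push_cast; linarith
  have hρ2 : Δ - C.ctr ≤ ((C.hw : ℚ) : ℝ) := by linarith
  have hhw : -C.hw ≤ C.hw := by
    have : (0 : ℚ) ≤ C.hw := by rw [EvenCellTM.hw]; positivity
    linarith
  have hℓΔ : (C.ℓ : ℝ) ≤ Δ := by
    have : ((C.ℓ : ℚ) : ℝ) ≤ ((C.lo : ℚ) : ℝ) := by exact_mod_cast hℓlo
    push_cast at this
    linarith
  have h1 := posOn_sound hS hX hhw hax hρ1 hρ2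
  have h2 := posOn_sound hS hY hhw hay hρ1 hρ2
  have h3 := posOnD_sound hS hax hay haz hD hhw hρ1 hρ2
  rw [ex] at h1 h3
  rw [ey] at h2 h3
  rw [ez] at h3
  refine evenHead_nonneg_of_reduced L.toFinset (fun i ab => (c i ab : ℝ)) C.ℓ C.F hF hFj hℓΔ p.1 p.2 h1.le h2.le ?_ a b
  nlinarith [h3]

/-- The head entry as the value of the real head polynomial on GIVEN row lists (existential contract). [folklore] -/
theorem evenHeadX_eq_evalR_rows {w : ℕ × ℕ → ℝ} {Sx : Finset (ℕ × ℕ)} {s σ : ℝ} (ℓ : ℕ) (ctr : ℚ) (F : List (ℕ × ℕ))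
    (ρ : ℝ) {row : ℕ → List ℝ} (hrow : ∀ q ∈ F, ∀ E : ℝ, qSum w Sx s σ E q.2 = evalR (row q.2) E)
    {asq : ℕ × ℕ → List ℝ} (hasq : ∀ q ∈ F, hrCoeff ((ctr : ℝ) + ρ) ℓ q.1 q.2 = evalR (asq q) ρ) :
    evenHeadX w Sx ℓ F s ((ctr : ℝ) + ρ) σ = evalR (headPolyTMR row asq ℓ ctr F) ρ := by
  rw [evalR_headPolyTMR, evenHeadX]
  congr 1
  refine List.map_congr_left fun q hq => ?_
  rw [← hrow q hq, ← hasq q hq, show (q.1 : ℝ) + (ctr : ℝ) + ρ = (ctr : ℝ) + ρ + (q.1 : ℝ) by ring]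
  have hlam : ((PointKernel.legendreLamQ ℓ : ℚ) : ℝ) = legendreLam ℓ := PointKernel.cast_legendreLamQ ℓ
  push_cast
  rw [hlam]
  have hl0 : legendreLam ℓ ≠ 0 := (legendreLam_pos ℓ).ne'
  have h2 : (2 : ℝ) ^ q.1 ≠ 0 := pow_ne_zero _ two_ne_zero
  rw [one_div_pow]
  field_simp

section Cells

variable (c : Fin 5 → ℕ × ℕ → ℚ) {L : List (ℕ × ℕ)} {C : EvenCellTM} (hF : C.F.Nodup)
  (hFj : ∀ q ∈ C.F, q.2 ≤ C.ℓ + q.1) (hℓlo : (C.ℓ : ℚ) ≤ C.lo) {σlo σhi εlo εhi : ℚ} {R : EvenRows}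
  (hR : R.ValidE c L σlo σhi εlo εhi)
include hF hFj hℓlo hR

/-- **Even head cell, FAST single-declaration form, on the existential row contract.** [cite: KosPolandSimmonsduffin2014, §3.3 eq. (3.16)] -/
theorem evenHead_nonneg_of_tmOK_E {dP : ℕ} (h : evenHeadTMOK R dP C = true) :
    ∀ p ∈ Icc (σlo : ℝ) σhi ×ˢ Icc (εlo : ℝ) εhi, ∀ Δ : ℝ, (C.lo : ℝ) ≤ Δ → Δ ≤ C.hi → ∀ a b : ℝ,
      0 ≤ ∑ q ∈ C.F.toFinset, hrCoeff Δ C.ℓ q.1 q.2 / legendreLam C.ℓ *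
        (taylorCrossing (1 / 2) (1 / 2) L.toFinset (fun i ab => (c i ab : ℝ))).evenForm p.1 p.2
          (zMono (Δ + (q.1 : ℝ)) q.2) a b := by
  intro p hp Δ hlo hhi a b
  obtain ⟨hσ, hε⟩ := hp
  simp only [evenHeadTMOK, Bool.and_eq_true, decide_eq_true_eq, List.all_eq_true] at h
  obtain ⟨⟨⟨⟨⟨⟨hS, hD⟩, hpiv⟩, hJ⟩, hX⟩, hY⟩, hDisc⟩ := h
  set ρ : ℝ := Δ - (C.ctr : ℝ) with hρdef
  have hΔ : Δ = (C.ctr : ℝ) + ρ := by rw [hρdef]; ring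
  have hlo' : ((C.lo : ℚ) : ℝ) = (C.ctr : ℝ) - ((C.hw : ℚ) : ℝ) := by rw [EvenCellTM.lo]; push_cast; ring
  have hhi' : ((C.hi : ℚ) : ℝ) = (C.ctr : ℝ) + ((C.hw : ℚ) : ℝ) := by rw [EvenCellTM.hi]; push_cast; ring
  have hρabs : |ρ| ≤ ((1 : ℚ) / 2 ^ C.e : ℚ) := by
    have : ((C.hw : ℚ) : ℝ) = (((1 : ℚ) / 2 ^ C.e : ℚ) : ℝ) := by rw [EvenCellTM.hw]
    rw [abs_le, ← this]; constructor <;> [ (push_cast; linarith) ; linarith ]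
  -- Taylor models at this ρ
  have htm : ∀ q ∈ C.F, ∃ as : List ℝ, PMem R.S as (HRTM.rowEntry (HRTM.rows R.S C.ctr C.ℓ C.e C.D C.nF) C.nF q.1 q.2) ∧
      hrCoeff ((C.ctr : ℝ) + ρ) C.ℓ q.1 q.2 = evalR as ρ :=
    fun q hq => HRTM.tmem_rows hD hpiv (C.le_nF q hq) q.2 ρ hρabs
  classical
  let asq : ℕ × ℕ → List ℝ := fun q => if hq : q ∈ C.F then Classical.choose (htm q hq) else []
  have hasq_mem : ∀ q ∈ C.F, PMem R.S (asq q) (HRTM.rowEntry (HRTM.rows R.S C.ctr C.ℓ C.e C.D C.nF) C.nF q.1 q.2) := by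
    intro q hq; simp only [asq, dif_pos hq]; exact (Classical.choose_spec (htm q hq)).1
  have hasq_val : ∀ q ∈ C.F, hrCoeff ((C.ctr : ℝ) + ρ) C.ℓ q.1 q.2 = evalR (asq q) ρ := by
    intro q hq; simp only [asq, dif_pos hq]; exact (Classical.choose_spec (htm q hq)).2
  -- rows from the existential contract (choose per j)
  have hV := fun j (hj : j < R.J) => hR.2 p.1 hσ p.2 hε j hj
  let rowX : ℕ → List ℝ := fun j => if hj : j < R.J then Classical.choose (hV j hj).1 else []
  let rowY : ℕ → List ℝ := fun j => if hj : j < R.J then Classical.choose (hV j hj).2.1 else []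
  let rowZ : ℕ → List ℝ := fun j => if hj : j < R.J then Classical.choose (hV j hj).2.2 else []
  have hrowX : ∀ q ∈ C.F, PMem R.S (rowX q.2) (R.RX.getD q.2 []) := by
    intro q hq; simp only [rowX, dif_pos (hJ q hq)]; exact (Classical.choose_spec (hV q.2 (hJ q hq)).1).1
  have hrowY : ∀ q ∈ C.F, PMem R.S (rowY q.2) (R.RY.getD q.2 []) := by
    intro q hq; simp only [rowY, dif_pos (hJ q hq)]; exact (Classical.choose_spec (hV q.2 (hJ q hq)).2.1).1
  have hrowZ : ∀ q ∈ C.F, PMem R.S (rowZ q.2) (R.RZ.getD q.2 []) := by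
    intro q hq; simp only [rowZ, dif_pos (hJ q hq)]; exact (Classical.choose_spec (hV q.2 (hJ q hq)).2.2).1
  have erowX : ∀ q ∈ C.F, ∀ E : ℝ, qSum (fun ab => (c 0 ab : ℝ)) L.toFinset p.1 (-1) E q.2 = evalR (rowX q.2) E := by
    intro q hq E; simp only [rowX, dif_pos (hJ q hq)]; exact (Classical.choose_spec (hV q.2 (hJ q hq)).1).2 E
  have erowY : ∀ q ∈ C.F, ∀ E : ℝ, qSum (fun ab => (c 1 ab : ℝ)) L.toFinset p.2 (-1) E q.2 = evalR (rowY q.2) E := by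
    intro q hq E; simp only [rowY, dif_pos (hJ q hq)]; exact (Classical.choose_spec (hV q.2 (hJ q hq)).2.1).2 E
  have erowZ : ∀ q ∈ C.F, ∀ E : ℝ, qSum (fun ab => (c 3 ab : ℝ)) L.toFinset ((p.1 + p.2) / 2) (-1) E q.2 +
      qSum (fun ab => (c 4 ab : ℝ)) L.toFinset ((p.1 + p.2) / 2) 1 E q.2 = evalR (rowZ q.2) E := by
    intro q hq E; simp only [rowZ, dif_pos (hJ q hq)]; exact (Classical.choose_spec (hV q.2 (hJ q hq)).2.2).2 E
  have hPX := pmem_headPolyTM hS (ℓ := C.ℓ) (ctr := C.ctr) C.F hrowX hasq_mem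
  have hPY := pmem_headPolyTM hS (ℓ := C.ℓ) (ctr := C.ctr) C.F hrowY hasq_mem
  have hPZ := pmem_headPolyTM hS (ℓ := C.ℓ) (ctr := C.ctr) C.F hrowZ hasq_mem
  have eX := evenHeadX_eq_evalR_rows (σ := (-1 : ℝ)) C.ℓ C.ctr C.F ρ (by intro q hq E; simpa using erowX q hq E) hasq_val
  have eY := evenHeadX_eq_evalR_rows (σ := (-1 : ℝ)) C.ℓ C.ctr C.F ρ (by intro q hq E; simpa using erowY q hq E) hasq_val
  -- Z: the sum of two evenHeadX's
  have eZ : evenHeadX (fun ab => (c 3 ab : ℝ)) L.toFinset C.ℓ C.F ((p.1 + p.2) / 2) ((C.ctr : ℝ) + ρ) (-1) +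
      evenHeadX (fun ab => (c 4 ab : ℝ)) L.toFinset C.ℓ C.F ((p.1 + p.2) / 2) ((C.ctr : ℝ) + ρ) 1 =
      evalR (headPolyTMR rowZ asq C.ℓ C.ctr C.F) ρ := by
    rw [evalR_headPolyTMR, evenHeadX, evenHeadX, ← List.sum_map_add]
    congr 1
    refine List.map_congr_left fun q hq => ?_
    have ez := erowZ q hq ((C.ctr : ℝ) + ρ + (q.1 : ℝ))
    rw [← hasq_val q hq, show (q.1 : ℝ) + (C.ctr : ℝ) + ρ = (C.ctr : ℝ) + ρ + (q.1 : ℝ) by ring, ← ez]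
    have hlam : ((PointKernel.legendreLamQ C.ℓ : ℚ) : ℝ) = legendreLam C.ℓ := PointKernel.cast_legendreLamQ C.ℓ
    push_cast
    rw [hlam]
    have hl0 : legendreLam C.ℓ ≠ 0 := (legendreLam_pos C.ℓ).ne'
    have h2 : (2 : ℝ) ^ q.1 ≠ 0 := pow_ne_zero _ two_ne_zero
    rw [one_div_pow]
    field_simp
  rw [hΔ]
  refine evenHead_psd_of_pmem c L hF hFj hℓlo hS hX hY hDisc p (by rw [← hΔ]; exact hlo) (by rw [← hΔ]; exact hhi)
    hPX hPY hPZ ?_ ?_ ?_ a b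
  · rw [show (C.ctr : ℝ) + ρ - C.ctr = ρ by ring, ← eX]
  · rw [show (C.ctr : ℝ) + ρ - C.ctr = ρ by ring, ← eY]
  · rw [show (C.ctr : ℝ) + ρ - C.ctr = ρ by ring, ← eZ]

end Cells

end Summit.CriticalPhenomena.Ising3D
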